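import Literature.MathematicalPhysics.QuantumFieldTheory.MirrorClusterOSSpace
import HarnessLib

/-!
# Cauchy–Schwarz for stencil vectors in the OS space of a mirror; configuration bookkeeping

Topic `Literature/MathematicalPhysics/QuantumFieldTheory` (theorems only: no definitions, no named
facts). A supplement to `MirrorClusterOSSpace.lean` (the reproducing-kernel Hilbert space
`MirrorOSData.Space` of the mirror kernel `K(a, b) = S(θ_n a ⊔ b)`, kernel vectors `gen a` with
`⟪gen a, gen b⟫ = K(a, b)`):

* `MirrorOSData.stencil_sq_le` — for clusters `P i, Q i, C` (`i ∈ ι`) and `Y`, the OS vector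
  `V = Σᵢ (δ_{P i} + δ_{Q i} - 2 δ_C)` ("stencil vector") satisfies the Cauchy–Schwarz inequality
  `⟪V, δ_Y⟫² ≤ ‖V‖² ‖δ_Y‖²`, written out in kernel entries (uses the tree's `corrFamily_comp_cast`). With one-point clusters at the points
  of a `7`-point stencil this is the DISCRETE NULL-VECTOR inequality by which a harmonic one-point
  Gram kernel forces harmonicity of `x ↦ S(x ⊔ Y)` (Glimm–Jaffe §6.1, Prop. 6.1.1, in finite form).
* `corrFamily_append_singleton`, `corrFamily_append_one_one`, `fin_cons_sub_eq` — arity bookkeeping for `Fin.append` / `Fin.cons` configurations.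

## References
* J. Glimm, A. Jaffe, *Quantum Physics* (2nd ed. 1987), §6.1, Prop. 6.1.1. [GlimmJaffe1987]
* K. Osterwalder, R. Schrader, Comm. Math. Phys. 31 (1973), §4.1.
-/

noncomputable section

open scoped InnerProductSpace BigOperators
open Literature.Probability.LatticeModels

namespace Literature.MathematicalPhysics.QuantumFieldTheory

variable {d : ℕ}

/-! ### Configuration bookkeeping -/

/-- `S_{1+m}({a} ⊔ y) = S_{m+1}(a :: y)`. [folklore] -/
theorem corrFamily_append_singleton (S : CorrFamily d) (a : EuclideanSpace ℝ (Fin d)) {m : ℕ}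
    (y : Fin m → EuclideanSpace ℝ (Fin d)) :
    S (1 + m) (Fin.append (fun _ : Fin 1 => a) y) = S (m + 1) (Fin.cons a y) := by
  rw [Fin.append_left_eq_cons]; exact corrFamily_comp_cast S (Nat.add_comm 1 m) _

/-- `S_{1+1}({a} ⊔ {b}) = S₂(a, b)`. [folklore] -/
theorem corrFamily_append_one_one (S : CorrFamily d) (a b : EuclideanSpace ℝ (Fin d)) :
    S (1 + 1) (Fin.append (fun _ : Fin 1 => a) (fun _ : Fin 1 => b)) = S 2 ![a, b] := by
  show S 2 _ = S 2 _
  congr 1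
  funext i
  fin_cases i <;> rfl

/-- Translating the first point and the cluster translates the whole configuration. [folklore] -/
theorem fin_cons_sub_eq (x v : EuclideanSpace ℝ (Fin d)) {m : ℕ} (y : Fin m → EuclideanSpace ℝ (Fin d)) :
    (Fin.cons (x - v) (fun i => y i - v) : Fin (m + 1) → EuclideanSpace ℝ (Fin d)) =
      fun j => (Fin.cons x y : Fin (m + 1) → EuclideanSpace ℝ (Fin d)) j + (-v) := by
  funext j
  refine Fin.cases ?_ (fun i => ?_) j
  · simp [sub_eq_add_neg]
  · simp [sub_eq_add_neg]

/-! ### Cauchy–Schwarz for a stencil vector in the OS space of a mirror -/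

/-- **The discrete null-vector inequality (Cauchy–Schwarz in the Osterwalder–Schrader space).** For
`MirrorOSData S n`, clusters `P i, Q i, C` (`i ∈ ι`) and `Y`, the OS vector
`V = Σᵢ (δ_{P i} + δ_{Q i} - 2 δ_C)` satisfies `⟪V, δ_Y⟫² ≤ ‖V‖² ‖δ_Y‖²`, i.e.
`(Σᵢ (K(Pᵢ,Y) + K(Qᵢ,Y) - 2K(C,Y)))² ≤ (Σ_{i'} (V[P i'] + V[Q i'] - 2 V[C])) · K(Y, Y)` with
`V[D] = Σᵢ (K(Pᵢ,D) + K(Qᵢ,D) - 2K(C,D))` (in the RKHS `MirrorOSData.Space`, `inner_gen_gen`,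
`norm_inner_le_norm`). [cite: GlimmJaffe1987, §6.1 Prop. 6.1.1] -/
theorem MirrorOSData.stencil_sq_le {S : CorrFamily d} {n : EuclideanSpace ℝ (Fin d)}
    (hOS : MirrorOSData S n) {ι : Type*} [Fintype ι]
    (P Q : ι → HalfSpaceCluster d n) (C Y : HalfSpaceCluster d n) :
    (∑ i, (mirrorKernel S n (P i) Y + mirrorKernel S n (Q i) Y - 2 * mirrorKernel S n C Y)) ^ 2 ≤
      (∑ i', ((∑ i, (mirrorKernel S n (P i) (P i') + mirrorKernel S n (Q i) (P i') -
                  2 * mirrorKernel S n C (P i'))) +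
              (∑ i, (mirrorKernel S n (P i) (Q i') + mirrorKernel S n (Q i) (Q i') -
                  2 * mirrorKernel S n C (Q i'))) -
              2 * (∑ i, (mirrorKernel S n (P i) C + mirrorKernel S n (Q i) C -
                  2 * mirrorKernel S n C C)))) *
        mirrorKernel S n Y Y := by
  obtain ⟨V, hV⟩ : ∃ V : hOS.Space, V = ∑ i, (hOS.gen (P i) + hOS.gen (Q i) - (2:ℂ) • hOS.gen C) :=
    ⟨_, rfl⟩
  have hVD : ∀ D : HalfSpaceCluster d n, ⟪V, hOS.gen D⟫_ℂ =
      ((∑ i, (mirrorKernel S n (P i) D + mirrorKernel S n (Q i) D - 2 * mirrorKernel S n C D) :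
        ℝ) : ℂ) := by
    intro D
    rw [hV, sum_inner, Complex.ofReal_sum]
    refine Finset.sum_congr rfl fun i _ => ?_
    rw [inner_sub_left, inner_add_left, inner_smul_left, hOS.inner_gen_gen, hOS.inner_gen_gen,
      hOS.inner_gen_gen, map_ofNat]
    push_cast
    ring
  have hVV : ⟪V, V⟫_ℂ = ((∑ i', ((∑ i, (mirrorKernel S n (P i) (P i') +
      mirrorKernel S n (Q i) (P i') - 2 * mirrorKernel S n C (P i'))) +
      (∑ i, (mirrorKernel S n (P i) (Q i') + mirrorKernel S n (Q i) (Q i') -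
        2 * mirrorKernel S n C (Q i'))) -
      2 * (∑ i, (mirrorKernel S n (P i) C + mirrorKernel S n (Q i) C -
        2 * mirrorKernel S n C C))) : ℝ) : ℂ) := by
    nth_rw 2 [hV]
    rw [inner_sum, Complex.ofReal_sum]
    refine Finset.sum_congr rfl fun i' _ => ?_
    rw [inner_sub_right, inner_add_right, inner_smul_right, hVD, hVD, hVD]
    push_cast
    ring
  have hcs := norm_inner_le_norm (𝕜 := ℂ) V (hOS.gen Y)
  rw [hVD Y, Complex.norm_real, Real.norm_eq_abs] at hcs
  have h1 : ‖V‖ ^ 2 = ∑ i', ((∑ i, (mirrorKernel S n (P i) (P i') +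
      mirrorKernel S n (Q i) (P i') - 2 * mirrorKernel S n C (P i'))) +
      (∑ i, (mirrorKernel S n (P i) (Q i') + mirrorKernel S n (Q i) (Q i') -
        2 * mirrorKernel S n C (Q i'))) -
      2 * (∑ i, (mirrorKernel S n (P i) C + mirrorKernel S n (Q i) C -
        2 * mirrorKernel S n C C))) := by
    rw [@norm_sq_eq_re_inner ℂ, hVV]
    simp only [RCLike.re_to_complex, Complex.ofReal_re]
  have h2 : ‖hOS.gen Y‖ ^ 2 = mirrorKernel S n Y Y := by
    rw [@norm_sq_eq_re_inner ℂ, hOS.inner_gen_gen]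
    simp only [RCLike.re_to_complex, Complex.ofReal_re]
  calc (∑ i, (mirrorKernel S n (P i) Y + mirrorKernel S n (Q i) Y - 2 * mirrorKernel S n C Y)) ^ 2
      = |∑ i, (mirrorKernel S n (P i) Y + mirrorKernel S n (Q i) Y -
          2 * mirrorKernel S n C Y)| ^ 2 := (sq_abs _).symm
    _ ≤ (‖V‖ * ‖hOS.gen Y‖) ^ 2 := pow_le_pow_left₀ (abs_nonneg _) hcs 2
    _ = _ := by rw [mul_pow, h1, h2]


end Literature.MathematicalPhysics.QuantumFieldTheory

end
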